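import Summits.RiemannHypothesis.RiemannHypothesis.Theorems.Splittings.BombieriTruncBandGap

/-!
# Splittings — x-wuc (xiv-b2, part 1/2): multiplicities — the screening principle (K2) on an invariant subspace with a retraction

Cell rh-split, seat rh-split-x-wuc g5 (brief sha16 f79c5f09d8bcb036), card `run/shared/lean/pub/rh-split/cards/SPLIT-x-wuc.md` §11
(referee rh-split-ref g3 2026-08-27T06:23:10Z: REPLAY PASS of the scratch `HOME/rh-split-x-wuc/SplitXWucG5.lean`; lead RULING #35:
cut (xiv)).  Carved VERBATIM from that scratch (file of record sha16 66b013c38c58c722); sections as numbered there.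
Typer split (rh-split-typer-1 g5, lead RULING #37 «b2 441 l: split or trim to ≤ 400 l at filing»): the cut module (xiv-b2)
`BombieriTruncMultiplicity` (441 l) is filed as TWO modules at the §9/§10 boundary, declarations byte-identical, same namespace.
* THIS PART: §9 `gram_zero_right`, `pairing_zero_right`, `exists_negRoot_of_screening_sub` (K2 on an invariant subspace `L` on which the
  Gram form is definite, with a retraction onto `L`).  Part 2/2 (`BombieriTruncMultiplicity`): §10 the class-constant subspace.  UNCONDITIONAL.
HONEST LABEL: «SPLITTING SEARCH over kernel-typed RH-EQUIVALENCES; a splitting A ∧ B ⟹ RH is CONDITIONAL bookkeeping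
unless A and B are both proved; nothing here bears on the truth of RH.»
-/

set_option linter.dupNamespace false

noncomputable section

open scoped Classical ComplexConjugate
open Set Filter Topology Complex MeasureTheory

namespace Summit.RiemannHypothesis.RiemannHypothesis.Theorems.Splittings.BombieriTruncMultiplicity

open Literature.NumberTheory.LFunctions Literature.NumberTheory.LFunctions.Bombieri2000
open Summit.RiemannHypothesis.RiemannHypothesis.Theses.RuelleBand
open Summit.RiemannHypothesis.RiemannHypothesis.Theorems.Splittings.BombieriTruncEigen
open Summit.RiemannHypothesis.RiemannHypothesis.Theorems.Splittings.BombieriFozNoDep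
open Summit.RiemannHypothesis.RiemannHypothesis.Theorems.Splittings.BombieriTruncGram
open Summit.RiemannHypothesis.RiemannHypothesis.Theorems.Splittings.BombieriTruncPairing
open Summit.RiemannHypothesis.RiemannHypothesis.Theorems.Splittings.BombieriTruncScreening
open Summit.RiemannHypothesis.RiemannHypothesis.Theorems.Splittings.BombieriTruncBandGap

variable {E : Set ℝ} {N : ℕ}

/-! ## §9 Multiplicities: the variational principle on an invariant subspace

(K2) needs the Gram form positive definite, which fails as soon as `Γ_N` carries a multiple zero. The cure is to
run the same argument on a subspace `L` on which the Gram form IS definite and off which the pencil form of an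
`L`-vector sees nothing (`gram v (w − π w) = pairing v (w − π w) = 0` for a retraction `π` onto `L`). For `ζ` the
right `L` is the space of coefficient vectors CONSTANT ON MULTIPLICITY CLASSES (§10). -/

/-- `gram E N x 0 = 0`. -/
@[simp] theorem gram_zero_right (x : truncIdx N → ℂ) : gram E N x 0 = 0 := by simp [gram]

/-- `pairing N x 0 = 0`. -/
@[simp] theorem pairing_zero_right (x : truncIdx N → ℂ) : pairing N x 0 = 0 := by simp [pairing]

/-- **(K2-L) screening on an invariant subspace.** [new] -/
theorem exists_negRoot_of_screening_sub {a : ℝ} (hE : E ⊆ Icc (-a) a) (L : Submodule ℂ (truncIdx N → ℂ))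
    (hG : ∀ x ∈ L, x ≠ 0 → 0 < ∫ u in E, ‖F N x u‖ ^ 2)
    (π : (truncIdx N → ℂ) → (truncIdx N → ℂ)) (hπL : ∀ w, π w ∈ L)
    (hπg : ∀ v ∈ L, ∀ w, gram E N v (w - π w) = 0) (hπp : ∀ v ∈ L, ∀ w, pairing N v (w - π w) = 0)
    {c : ℝ} (hc : 0 < c) {x : truncIdx N → ℂ} (hxL : x ∈ L)
    (hx : ∫ u in E, ‖F N x u‖ ^ 2 < c * -(pairing N x x).re) :
    ∃ μ ∈ (truncKMat E N).charpoly.roots, μ.im = 0 ∧ -c < μ.re ∧ μ.re < 0 := by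
  -- the pencil of quadratic forms
  set q : ℝ → (truncIdx N → ℂ) → ℝ := fun t w ↦ (gram E N w w).re + t * (pairing N w w).re with hqdef
  have hq_cont : ∀ t, Continuous (q t) := by
    intro t
    simp only [hqdef, gram, pairing]
    fun_prop
  have hq_smul : ∀ t (r : ℝ) w, q t ((r : ℂ) • w) = r ^ 2 * q t w := by
    intro t r w
    simp only [hqdef, gram_real_smul, pairing_real_smul, Complex.re_ofReal_mul]
    ring
  -- the unit sphere of `L` is compact
  have hLclosed : IsClosed (L : Set (truncIdx N → ℂ)) := L.closed_of_finiteDimensional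
  set S : Set (truncIdx N → ℂ) := {w | ∑ j, ‖w j‖ ^ 2 = 1} ∩ (L : Set (truncIdx N → ℂ)) with hSdef
  have hnormsq_cont : Continuous fun w : truncIdx N → ℂ ↦ ∑ j, ‖w j‖ ^ 2 := by fun_prop
  have hS : IsCompact S := by
    refine IsCompact.inter_right ?_ hLclosed
    refine Metric.isCompact_of_isClosed_isBounded (isClosed_eq hnormsq_cont continuous_const) ?_
    refine (Metric.isBounded_closedBall (x := (0 : truncIdx N → ℂ)) (r := 1)).subset fun w hw ↦ ?_
    rw [mem_closedBall_zero_iff, pi_norm_le_iff_of_nonneg zero_le_one]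
    intro j
    have hw' : ∑ j, ‖w j‖ ^ 2 = 1 := hw
    have h1 : ‖w j‖ ^ 2 ≤ 1 := by
      rw [← hw']
      exact Finset.single_le_sum (f := fun j ↦ ‖w j‖ ^ 2) (fun i _ ↦ by positivity) (Finset.mem_univ j)
    nlinarith [norm_nonneg (w j)]
  have hSmem : ∀ {w}, w ∈ S ↔ ∑ j, ‖w j‖ ^ 2 = 1 ∧ w ∈ L := fun {w} ↦ Iff.rfl
  have hx0 : x ≠ 0 := by
    rintro rfl
    simp at hx
  obtain ⟨r, hr, hrS⟩ := exists_unit_smul hx0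
  have hrS' : (r : ℂ) • x ∈ S := hSmem.2 ⟨hrS, L.smul_mem _ hxL⟩
  have hSne : S.Nonempty := ⟨_, hrS'⟩
  -- minimisers of each form on the sphere, and the least value m(t)
  have hmin : ∀ t : ℝ, ∃ z ∈ S, IsMinOn (q t) S z := fun t ↦ hS.exists_isMinOn hSne (hq_cont t).continuousOn
  choose z hzS hzmin using hmin
  set m : ℝ → ℝ := fun t ↦ q t (z t) with hmdef
  have hpS : ∀ w ∈ S, |(pairing N w w).re| ≤ 1 := fun w hw ↦
    (abs_pairing_self_re_le w).trans (le_of_eq (hSmem.1 hw).1)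
  have hm_lip : LipschitzWith 1 m := by
    refine LipschitzWith.of_le_add fun t s ↦ ?_
    have h1 : m t ≤ q t (z s) := hzmin t (hzS s)
    have h2 : q t (z s) = m s + (t - s) * (pairing N (z s) (z s)).re := by
      simp only [hmdef, hqdef]; ring
    have h3 : (t - s) * (pairing N (z s) (z s)).re ≤ dist t s := by
      rw [Real.dist_eq]
      have h4 := hpS (z s) (hzS s)
      calc (t - s) * (pairing N (z s) (z s)).re ≤ |(t - s) * (pairing N (z s) (z s)).re| := le_abs_self _
        _ = |t - s| * |(pairing N (z s) (z s)).re| := abs_mul _ _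
        _ ≤ |t - s| * 1 := mul_le_mul_of_nonneg_left h4 (abs_nonneg _)
        _ = |t - s| := mul_one _
    linarith
  have hm_cont : Continuous m := hm_lip.continuous
  -- signs at the endpoints
  have hm0 : 0 < m 0 := by
    have hz0 : z 0 ≠ 0 := by
      intro h
      have h' : ∑ j, ‖z 0 j‖ ^ 2 = 1 := (hSmem.1 (hzS 0)).1
      rw [h] at h'
      simp at h'
    have h1 : m 0 = ∫ u in E, ‖F N (z 0) u‖ ^ 2 := by
      simp only [hmdef, hqdef, zero_mul, add_zero, gram_self_re hE]
    rw [h1]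
    exact hG _ (hSmem.1 (hzS 0)).2 hz0
  have hmc : m c < 0 := by
    have h1 : m c ≤ q c ((r : ℂ) • x) := hzmin c hrS'
    have h2 : q c ((r : ℂ) • x) = r ^ 2 * q c x := hq_smul c r x
    have h3 : q c x < 0 := by
      simp only [hqdef, gram_self_re hE]
      linarith
    have h4 : r ^ 2 * q c x < 0 := mul_neg_of_pos_of_neg (pow_pos hr 2) h3
    linarith
  -- intermediate value theorem
  obtain ⟨t₀, ht₀I, ht₀⟩ : ∃ t₀ ∈ Icc (0 : ℝ) c, m t₀ = 0 :=
    intermediate_value_Icc' hc.le hm_cont.continuousOn ⟨hmc.le, hm0.le⟩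
  have ht₀0 : 0 < t₀ := by
    rcases eq_or_lt_of_le ht₀I.1 with h | h
    · rw [← h] at ht₀; linarith
    · exact h
  have ht₀c : t₀ < c := by
    rcases eq_or_lt_of_le ht₀I.2 with h | h
    · rw [h] at ht₀; linarith
    · exact h
  -- the minimiser at t₀
  set v := z t₀ with hvdef
  have hvS : ∑ j, ‖v j‖ ^ 2 = 1 := (hSmem.1 (hzS t₀)).1
  have hvL : v ∈ L := (hSmem.1 (hzS t₀)).2
  have hv0 : v ≠ 0 := by
    intro h
    rw [h] at hvS
    simp at hvS
  have hqv : q t₀ v = 0 := ht₀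
  have hnonneg : ∀ w ∈ L, 0 ≤ q t₀ w := by
    intro w hwL
    by_cases hw : w = 0
    · subst hw
      simp [hqdef]
    obtain ⟨ρ, hρ, hρS⟩ := exists_unit_smul hw
    have h1 : 0 ≤ q t₀ ((ρ : ℂ) • w) := by
      rw [← hqv]; exact hzmin t₀ (hSmem.2 ⟨hρS, L.smul_mem _ hwL⟩)
    rw [hq_smul] at h1
    by_contra hneg
    push Not at hneg
    nlinarith [pow_pos hρ 2]
  -- the pencil sesquilinear form at t₀ and its polarisation inside `L`
  set Bf : (truncIdx N → ℂ) → (truncIdx N → ℂ) → ℂ :=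
    fun w₁ w₂ ↦ gram E N w₁ w₂ + (t₀ : ℂ) * pairing N w₁ w₂ with hBf
  have hBq : ∀ w, (Bf w w).re = q t₀ w := by
    intro w
    simp only [hBf, hqdef, Complex.add_re, Complex.re_ofReal_mul]
  have hBconj : ∀ w₁ w₂, conj (Bf w₂ w₁) = Bf w₁ w₂ := by
    intro w₁ w₂
    simp only [hBf, map_add, map_mul, Complex.conj_ofReal, conj_gram, conj_pairing]
  have hBadd_left : ∀ w₁ w₂ w₃, Bf (w₁ + w₂) w₃ = Bf w₁ w₃ + Bf w₂ w₃ := by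
    intro w₁ w₂ w₃
    simp only [hBf, gram_add_left, pairing_add_left]
    ring
  have hBadd_right : ∀ w₁ w₂ w₃, Bf w₁ (w₂ + w₃) = Bf w₁ w₂ + Bf w₁ w₃ := by
    intro w₁ w₂ w₃
    simp only [hBf, gram_add_right, pairing_add_right]
    ring
  have hBsmul_left : ∀ (κ : ℂ) w₁ w₂, Bf (κ • w₁) w₂ = conj κ * Bf w₁ w₂ := by
    intro κ w₁ w₂
    simp only [hBf, gram_smul_left, pairing_smul_left]
    ring
  have hBsmul_right : ∀ (κ : ℂ) w₁ w₂, Bf w₁ (κ • w₂) = κ * Bf w₁ w₂ := by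
    intro κ w₁ w₂
    simp only [hBf, gram_smul_right, pairing_smul_right]
    ring
  have hRe : ∀ w ∈ L, (Bf v w).re = 0 := by
    intro w hwL
    set R := (Bf v w).re with hR
    set C := (Bf w w).re with hC
    have hC0 : 0 ≤ C := by rw [hC, hBq]; exact hnonneg w hwL
    have hvv : (Bf v v).re = 0 := by rw [hBq]; exact hqv
    have hwv : (Bf w v).re = R := by rw [hR, ← hBconj v w, Complex.conj_re]
    have key : ∀ s : ℝ, 0 ≤ 2 * s * R + s ^ 2 * C := by
      intro s
      have h := hnonneg (v + (s : ℂ) • w) (L.add_mem hvL (L.smul_mem _ hwL))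
      rw [← hBq] at h
      have hexp : Bf (v + (s : ℂ) • w) (v + (s : ℂ) • w) =
          Bf v v + (s : ℂ) * Bf v w + ((s : ℂ) * Bf w v + (s : ℂ) * ((s : ℂ) * Bf w w)) := by
        rw [hBadd_left, hBadd_right, hBadd_right, hBsmul_right, hBsmul_left, hBsmul_left, hBsmul_right,
          Complex.conj_ofReal]
      rw [hexp] at h
      simp only [Complex.add_re, Complex.re_ofReal_mul, hvv, hwv] at h
      nlinarith [h]
    by_contra hR0
    have hR2 : 0 < R ^ 2 := by positivity
    have hC1 : 0 < C + 1 := by linarith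
    have h := key (-R / (C + 1))
    have h' : 2 * (-R / (C + 1)) * R + (-R / (C + 1)) ^ 2 * C = -(R ^ 2 * (C + 2) / (C + 1) ^ 2) := by
      field_simp
      ring
    rw [h'] at h
    have h'' : 0 < R ^ 2 * (C + 2) / (C + 1) ^ 2 := by positivity
    linarith
  have hB0L : ∀ w ∈ L, Bf v w = 0 := by
    intro w hwL
    apply Complex.ext
    · simpa using hRe w hwL
    · have h := hRe (I • w) (L.smul_mem _ hwL)
      rw [hBsmul_right, Complex.mul_re, Complex.I_re, Complex.I_im, zero_mul, one_mul, zero_sub] at h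
      simp only [Complex.zero_im]
      linarith
  -- off `L` the form of `v` sees nothing
  have hB0 : ∀ w, Bf v w = 0 := by
    intro w
    have hw : w = π w + (w - π w) := (add_sub_cancel (π w) w).symm
    rw [hw, hBadd_right, hB0L (π w) (hπL w)]
    simp only [hBf, hπg v hvL w, hπp v hvL w, mul_zero, add_zero]
  -- read off `G v = −t₀ P v` row by row with `w = e_i`
  have hrowG : ∀ i : truncIdx N,
      ∑ l : truncIdx N, KE E (conj ((i : ZeroIdx).gamma)) ((l : ZeroIdx).gamma) * v l =
        -(t₀ : ℂ) * v (tbar i) := by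
    intro i
    have h := hB0 (Pi.single i 1)
    rw [← hBconj] at h
    have hg : gram E N (Pi.single i 1) v =
        ∑ l : truncIdx N, KE E (conj ((i : ZeroIdx).gamma)) ((l : ZeroIdx).gamma) * v l := by
      rw [gram, Finset.sum_eq_single i (fun j _ hj ↦ by simp [hj]) (by simp)]
      exact Finset.sum_congr rfl fun l _ ↦ by simp; ring
    have hp : pairing N (Pi.single i 1) v = v (tbar i) := by
      rw [pairing, Finset.sum_eq_single i (fun j _ hj ↦ by simp [hj]) (by simp)]
      simp
    have h2 : Bf (Pi.single i 1) v = 0 := by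
      rw [← map_zero conj, ← h, Complex.conj_conj]
    simp only [hBf, hg, hp] at h2
    linear_combination h2
  -- hence `𝒦 v = −t₀ v`
  have hK : (truncKMat E N).mulVec v = ((-t₀ : ℝ) : ℂ) • v := by
    funext l
    have h := hrowG (tbar l)
    rw [gamma_tbar, Complex.conj_conj, tbar_tbar] at h
    simp only [Pi.smul_apply, smul_eq_mul, Complex.ofReal_neg]
    simpa [Matrix.mulVec, dotProduct, truncKMat, KMat] using h
  refine ⟨((-t₀ : ℝ) : ℂ), Literature.Analysis.InnerProduct.mem_roots_charpoly_of_mulVec_eq_smul hv0 hK,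
    Complex.ofReal_im _, ?_, ?_⟩
  · rw [Complex.ofReal_re]; linarith
  · rw [Complex.ofReal_re]; linarith

end Summit.RiemannHypothesis.RiemannHypothesis.Theorems.Splittings.BombieriTruncMultiplicity
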